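import Literature.AlgebraicGeometry.HodgeTheory.HodgeRiemannPolarizabilityProofs
import Literature.AlgebraicGeometry.HodgeTheory.MonodromyOrbitLatticeFiniteness
import Literature.AlgebraicGeometry.HodgeTheory.ArapuraSurfaceFibredFourfoldsProofs
import Literature.AlgebraicGeometry.HodgeTheory.HardLefschetzThreefold
import Literature.AlgebraicGeometry.HodgeTheory.GysinFormalismHodgeOfGysin
import Literature.AlgebraicTopology.SingularHomology.FiltrationLefschetzCupGeneration
import HarnessLib

/-!
# Finite monodromy on `H²` for smooth projective families of surfaces with `p_g = 0`

Family `hodge`, layer `Literature/AlgebraicGeometry/HodgeTheory`. PROOF FILE (everything here is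
PROVED; no definition and no named fact is introduced, D-0026). Part (M1) of the monodromy route to
the smooth part of Arapura's Cor. 1.5 (`ArapuraSurfaceFibredFourfoldsSplit.lean`): the classical
finiteness of the monodromy of a polarised variation of Hodge structure of pure type `(1,1)` with an
integral structure (Deligne, *Théorie de Hodge II*, 4.2; Cattani–Deligne–Kaplan 1995, §1; Voisin,
*Hodge Theory II*, §3.1–3.2), in the case consumed there: for a smooth projective family
`f : 𝒳 ⟶ S` of SURFACES over a smooth quasi-projective complex base and a fibre `X_s` of geometric
genus `0` (`H^{2,0}(X_s) = 0`, so that `H²(X_s(ℂ); ℂ) = H^{1,1}`), EVERY rational class of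
`H²(X_s(ℂ); ℂ)` has a FINITE monodromy orbit (finitely many flat continuations along loops at `s`).

The proof is the lattice argument of the tree (`finite_setOf_isContinuationAlong_of_norm_eq`,
file `MonodromyOrbitLatticeFiniteness`: integral classes of bounded norm for a positive rational form
are finite in number, and the integral structure is flat) fed with a TRANSPORT-INVARIANT positive
definite rational form on `H²(X_s(ℂ); ℂ)`, which is where `p_g = 0` enters:

* `exists_fubiniStudy_eq_smul_map` / `exists_kaehlerRationalDatum_Hη_eq_smul_map` — for a smooth
  projective `X` with a GIVEN closed immersion `ι : X ⟶ ℙᴺ`, a Kähler–rational datum of `X`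
  (`KaehlerRationalDatum`, file `HodgeRiemannPolarizabilityProofs`) whose rational Kähler class is a
  complex multiple of `ι^* ρ` for a rational class `ρ ∈ H²(ℙᴺ(ℂ); ℂ)` — the proof of
  `exists_fubiniStudy_rational` (file `FubiniStudyClassRational`, where the immersion is the one of
  `IsSmoothProjective`) run for the given `ι`, keeping the identity `H = r · ι(ℂ)^* c_ℙ` it proves.
  In a family this makes the Kähler class of the fibre the restriction of a GLOBAL class, hence
  invariant under transport (`transportFun_map_fiberι`).
* `cTrace_cup_self_neg_of_primitive` / `cTrace_cup_Hη_Hη_pos` — the SIGNED Hodge index theorem of a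
  smooth projective surface for the intersection form `B(x, y) = τ(x ∪ y)` of such a datum
  (`τ = KaehlerRationalDatum.cTrace`, the normalised trace): `B(κ, κ) > 0` for the Kähler class `κ`
  and `B(y, y) < 0` for every non-zero rational `(1,1)`-class `y` with `κ ∪ y = 0` — the cases
  `a = 0` and `a = 2` of the Hodge–Riemann relation `KaehlerRationalDatum.hodgeRiemann_X`
  (Voisin I Thm. 6.32; Hartshorne V Thm. 1.9 with its sign).
* `indexForm` bookkeeping (`2 B(κ,x) B(κ,y) - B(κ,κ) B(x,y)`, proved positive definite on the
  rational classes when `H² = H^{1,1}`, rational on rational classes, and invariant under every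
  `ℂ`-linear map preserving cup products, `κ` and acting trivially on the line `H⁴`).
* `finite_setOf_isContinuationAlong_of_pg_zero` — **the theorem**: `f : 𝒳 ⟶ S` a smooth projective
  family of relative dimension `2` over a quasi-projective `S` smooth of pure dimension `d`,
  `s ∈ S(ℂ)` with `dim H^{2,0}(X_s) = 0` (a Hodge model with `finrank H^{2,0} = 0`, as in
  `ArapuraSurfaceFibredFourfoldsSplit`), `j : 𝒳 ⟶ ℙᴹ` a morphism whose composite with the fibre
  inclusion `X_s ⟶ 𝒳` is a closed immersion; then for every rational `α ∈ H²(X_s(ℂ); ℂ)` the set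
  `{β | ∃ γ : Path s s, IsContinuationAlong γ α β}` is finite.

## References

* [DeligneHodgeII1971] P. Deligne, Théorie de Hodge II, Publ. Math. IHÉS 40 (1971), 4.2.
* [CattaniDeligneKaplan1995JAMS] E. Cattani, P. Deligne, A. Kaplan, On the locus of Hodge classes,
  J. Amer. Math. Soc. 8 (1995), §1.
* [VoisinHodgeI2002] C. Voisin, Hodge Theory and Complex Algebraic Geometry I, CUP 2002, §6.3.2
  Thm. 6.32, §7.1.2, §7.1.3 Thm. 7.10.
* [VoisinHodgeII2003] C. Voisin, Hodge Theory and Complex Algebraic Geometry II, CUP 2003, §3.1.2.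
* [Hartshorne1977] R. Hartshorne, Algebraic Geometry, GTM 52, V Thm. 1.9, Rem. 1.9.1.
* [Arapura2022] D. Arapura, Hodge cycles and the Leray filtration, Pacific J. Math. 319 (2022),
  proof of Cor. 1.5 (p. 5: "after a finite base change").
-/

open CategoryTheory AlgebraicGeometry Limits
open Literature.AlgebraicGeometry.Motives

universe u

noncomputable section

namespace Literature.AlgebraicGeometry.HodgeTheory

open Literature.AlgebraicGeometry.Motives.AnalytificationKaehler
open Literature.NumberTheory.Transcendental Literature.Geometry.Kaehler
open Literature.AlgebraicTopology.SingularHomology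
open scoped Manifold ContDiff Topology

/-! ### The restricted Fubini–Study class of a GIVEN immersion is a multiple of a global rational class -/

section FubiniStudy

variable {n : ℕ} {X : SchemeOver ℂ}

/-- **The restricted Fubini–Study class of a given closed immersion `ι : X ⟶ ℙᴺ` is a complex
multiple of the pull-back of a rational class of `ℙᴺ`.** For `X` smooth projective of dimension
`n` and a closed immersion `ι`, there are a Hodge model `A`, a natural multiplicative real de Rham
family `e`, the class `H ∈ H²(X(ℂ); ℂ)` with `A^* H = e[θ] ⊗ 1` for the restricted Fubini–Study
form `θ` of `ι`, a RATIONAL class `ρ ∈ H²(ℙᴺ(ℂ); ℂ)` and `μ ∈ ℂ` with `H = μ • ι(ℂ)^* ρ`. This is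
the proof of `exists_fubiniStudy_rational` (immersion chosen by `IsSmoothProjective`) run for the
given `ι`: `θ = (ι^an)^* θ_ℙ` (`fubiniStudyPullbackForm_eq_pullback`), the induced comparison and
the rigidity of natural de Rham comparisons give `H = r · ι(ℂ)^* c_ℙ`, and `H²(ℙᴺ(ℂ); ℂ) ≅ ℂ` is
spanned by a rational class. [cite: VoisinHodgeI2002, §7.1.2 and §7.1.3 Thm. 7.10]
[cite: SerreGAGA1956, §2 n°5] [cite: HatcherAT2002, Thm. 3.19] -/
theorem exists_fubiniStudy_eq_smul_map (hX : Motives.IsSmoothProjective n X) {N : ℕ}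
    (ι : X ⟶ projectiveSpace N ℂ) [hι : IsClosedImmersion ι.left] :
    ∃ (A : HodgeModel n X) (e : DeRhamIsoFamily 𝓘(ℝ, A.model)) (_ : e.IsNatural) (_ : e.IsMultiplicative)
      (hθ : fubiniStudyPullbackForm A.model ι A.toComplexPoints ∈ closedSmoothForms 𝓘(ℝ, A.model) A.carrier ℝ 2)
      (H : complexBetti X 2) (ρ : complexBetti (projectiveSpace N ℂ) 2) (μ : ℂ),
      A.pullback 2 H = ofRealClass A.carrier 2 (e A.carrier 2
        (deRhamCohomology.mk ⟨fubiniStudyPullbackForm A.model ι A.toComplexPoints, hθ⟩)) ∧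
      IsRationalClass ρ ∧ H = μ • complexBetti.map ι 2 ρ := by
  obtain ⟨B, -⟩ := exists_isReal_hodgeModel_holds n X hX
  have hP : Motives.IsSmoothProjective N (Motives.projectiveSpace N ℂ) :=
    Motives.isSmoothProjective_projectiveSpace_holds ℂ N
  obtain ⟨A, -⟩ := exists_isReal_hodgeModel_holds N (Motives.projectiveSpace N ℂ) hP
  obtain ⟨e, he, hem, -⟩ := exists_deRhamIsoFamily_holds B.model
  have hθ := B.fubiniStudyPullbackForm_mem_closedSmoothForms ι
  obtain ⟨H, hH⟩ := B.pullback_surjective 2 (ofRealClass B.carrier 2 (e B.carrier 2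
    (deRhamCohomology.mk ⟨fubiniStudyPullbackForm B.model ι B.toComplexPoints, hθ⟩)))
  refine ⟨B, e, he, hem, hθ, H, ?_⟩
  -- the analytified embedding and `θ_X = (ι^an)^* θ_ℙ`
  have hmn : n ≤ N := dim_le_of_isClosedImmersion_projectiveSpace hX ι B A
  set f := HodgeModel.anMap A B ι with hfdef
  have hfan : ContMDiff 𝓘(ℝ, B.model) 𝓘(ℝ, A.model) ∞ f := HodgeModel.contMDiff_anMap A B ι hX hP
  have hfd : MDifferentiable 𝓘(ℝ, B.model) 𝓘(ℝ, A.model) f :=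
    (HodgeModel.mdifferentiable_anMap A B ι hX hP).real_of_complex
  have hθX := fubiniStudyPullbackForm_eq_pullback ι (E := B.model) (φ := B.toComplexPoints)
    A.isAnalytification (f := f) (HodgeModel.toComplexPoints_anMap A B ι) hfd
  have hθP := A.fubiniStudyPullbackForm_mem_closedSmoothForms (𝟙 (Motives.projectiveSpace N ℂ))
  -- the de Rham classes of `θ_ℙ ⊗ 1` and `θ_X ⊗ 1`
  set wP : complexDeRhamCohomology A.model A.carrier 2 :=
    complexDeRhamCohomology.ofReal A.model A.carrier 2
      (deRhamCohomology.mk ⟨fubiniStudyPullbackForm A.model (𝟙 (Motives.projectiveSpace N ℂ)) A.toComplexPoints, hθP⟩) with hwP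
  set wX : complexDeRhamCohomology B.model B.carrier 2 :=
    complexDeRhamCohomology.ofReal B.model B.carrier 2
      (deRhamCohomology.mk ⟨fubiniStudyPullbackForm B.model ι B.toComplexPoints, hθ⟩) with hwX
  have hwPX : complexDeRhamCohomology.map B.model hfan 2 wP = wX := by
    rw [hwP, hwX, complexDeRhamCohomology.ofReal_mk, complexDeRhamCohomology.ofReal_mk,
      complexDeRhamCohomology.map_mk]
    congr 1
    apply Subtype.ext
    change (fubiniStudyPullbackForm A.model (𝟙 (Motives.projectiveSpace N ℂ)) A.toComplexPoints).ofReal.pullback 𝓘(ℝ, B.model) f =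
      (fubiniStudyPullbackForm B.model ι B.toComplexPoints).ofReal
    rw [hθX, mform_ofReal_pullback]
  -- a class `c_ℙ` on `ℙᴺ(ℂ)` comparing to `θ_ℙ ⊗ 1` in the model `A`
  obtain ⟨cP, hcP⟩ := A.pullback_surjective 2 (A.deRham A.carrier 2 wP)
  -- compatibility compactness instances on `X^an`
  haveI : CompactSpace B.carrier := by
    haveI := Motives.ComplexPoints.compactSpace_of_isSmoothProjective hX
    exact B.isAnalytification.homeomorph.symm.compactSpace
  -- the induced comparison: `B^*(ι^* c_ℙ) = e''[θ_X ⊗ 1]`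
  have hd : HodgeModel.inducedIso A B hmn B.carrier 2 wX =
      B.pullback 2 (singularCohomology.map ℂ ℂ (Motives.AlgPoints.mapContinuous (L := ℂ) ι) 2 cP) := by
    rw [← hwPX, HodgeModel.inducedIso_apply,
      ← LinearMap.comp_apply (g := complexDeRhamCohomology.map B.model hfan 2),
      ← complexDeRhamCohomology.map_comp hfan (contMDiff_cylFst A B hmn B.carrier),
      A.deRham_isNatural (Cyl A B hmn B.carrier) A.carrier _
        (hfan.comp (contMDiff_cylFst A B hmn B.carrier)) 2 wP,
      ← hcP, ← HodgeModel.map_anMap_pullback]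
    change ((singularCohomology.map ℂ ℂ _ 2 ≫ singularCohomology.map ℂ ℂ _ 2).hom _) = _
    rw [← singularCohomology.map_comp]
    rfl
  -- rigidity: `e ⊗ ℂ = r • e''` on `H²_dR(X^an; ℂ)`
  obtain ⟨r, hr⟩ := NaturalDeRhamComparisonRigidity_holds B.model B.model
    (HodgeModel.inducedFamily A B hmn) (HodgeModel.isNatural_inducedFamily A B hmn)
    e.complexify (DeRhamIsoFamily.complexify_isNatural he) B.carrier B.carrier (Homeomorph.refl _)
    contMDiff_id contMDiff_id 2
  have hrX : e.complexify B.carrier 2 wX = r • HodgeModel.inducedIso A B hmn B.carrier 2 wX := by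
    have h := hr wX
    have hid : (⟨Homeomorph.refl B.carrier, (Homeomorph.refl B.carrier).continuous⟩ :
        C(B.carrier, B.carrier)) = ContinuousMap.id B.carrier := rfl
    rw [hid, singularCohomology.map_id] at h
    change e.complexify B.carrier 2 wX =
      r • HodgeModel.inducedIso A B hmn B.carrier 2 (complexDeRhamCohomology.map B.model contMDiff_id 2 wX) at h
    rwa [complexDeRhamCohomology.map_id, LinearMap.id_apply] at h
  -- hence `H = r • ι^* c_ℙ`
  have hH' : H = r • singularCohomology.map ℂ ℂ (Motives.AlgPoints.mapContinuous (L := ℂ) ι) 2 cP := by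
    apply B.pullback_injective 2
    rw [hH, _root_.map_smul, ← hd, ← hrX, complexify_apply, hwX, complexifyFun_ofReal]
  -- `H²(ℙᴺ(ℂ); ℂ)` is spanned by one rational class
  rcases Nat.eq_zero_or_pos N with hN | hN
  · subst hN
    haveI := Motives.ComplexPoints.subsingleton_singularCohomology_of_lt hP ℂ (k := 2) (by omega)
    refine ⟨0, 0, hH, IsRationalClass.zero, ?_⟩
    rw [hH', Subsingleton.elim cP 0, map_zero, smul_zero, zero_smul]
  have h1 : Module.finrank ℂ (complexBetti (Motives.projectiveSpace N ℂ) 2) = 1 :=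
    finrank_complexBetti_projectiveSpace_two_mul_eq_one N (p := 1) hN
  obtain ⟨rP, hrP, -, hspan⟩ := exists_mem_ne_zero_of_span_eq_top
    (span_isRationalClass_eq_top_of_isSmoothProjective_holds N (Motives.projectiveSpace N ℂ) hP 2) h1
  obtain ⟨lam, hlam⟩ := hspan cP
  refine ⟨rP, r * lam, hH, hrP, ?_⟩
  rw [hH', ← hlam, _root_.map_smul, smul_smul]

/-- **A Kähler–rational datum whose Kähler class is the restriction of a global rational class.**
For `X` smooth projective of dimension `n` with a closed immersion `ι : X ⟶ ℙᴺ` there is a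
Kähler–rational datum `D` of `X` (`KaehlerRationalDatum`: real Hodge model, natural multiplicative
de Rham family, Kähler metric and RATIONAL Kähler class `D.Hη`) with `D.Hη = c • ι(ℂ)^* ρ` for a
rational `ρ ∈ H²(ℙᴺ(ℂ); ℂ)` and `c ∈ ℂ`: the Kähler metric is (a positive multiple of) the
restricted Fubini–Study metric of `ι` (`isKaehlerClassVia_of_pullback_eq_fubiniStudyPullbackForm`,
Voisin I §3.3.2 Lemma 3.16) and its class is `μ • ι(ℂ)^* ρ` (`exists_fubiniStudy_eq_smul_map`), with
`μ` real because Kähler and rational classes are real, so that `|μ|⁻¹ H = ± ι(ℂ)^* ρ` is rational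
(the argument of `nonempty_kaehlerRationalDatum`). [cite: VoisinHodgeI2002, §7.1.2, §7.1.3 Thm. 7.10 and §3.3.2 Lemma 3.16] -/
theorem exists_kaehlerRationalDatum_Hη_eq_smul_map (hX : Motives.IsSmoothProjective n X) {N : ℕ}
    (ι : X ⟶ projectiveSpace N ℂ) [IsClosedImmersion ι.left] :
    ∃ (D : KaehlerRationalDatum n X) (ρ : complexBetti (projectiveSpace N ℂ) 2) (c : ℂ),
      IsRationalClass ρ ∧ D.Hη = c • complexBetti.map ι 2 ρ := by
  obtain ⟨A, e, he, hem, hθ, H, ρ, μ, hH, hρ, hHμ⟩ := exists_fubiniStudy_eq_smul_map hX ι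
  have hKV : A.IsKaehlerClassVia e H :=
    A.isKaehlerClassVia_of_pullback_eq_fubiniStudyPullbackForm e hX ι hθ hH
  set ρX : complexBetti X 2 := complexBetti.map ι 2 ρ with hρX
  have hρXrat : IsRationalClass ρX := IsRationalClass.map _ hρ
  -- it suffices to find `r > 0` with `r • H` rational
  suffices hrat : ∃ r : ℝ, 0 < r ∧ IsRationalClass ((r : ℂ) • H) by
    obtain ⟨r, hr, hrat⟩ := hrat
    have hKV' : A.IsKaehlerClassVia e ((r : ℂ) • H) := hKV.smul_of_pos hr
    obtain ⟨η, hη⟩ := (isRationalClass_iff_mem_range_ofRatClass _).1 hrat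
    obtain ⟨g, hg, hgH⟩ := hKV'
    refine ⟨⟨A, e, he, hem, g, hg, η, by rw [hη]; exact hgH⟩, ρ, (r : ℂ) * μ, hρ, ?_⟩
    change ofRatClass (Motives.ComplexPoints X) 2 η = ((r : ℂ) * μ) • ρX
    rw [hη, hHμ, smul_smul]
  by_cases h0 : μ • ρX = 0
  · refine ⟨1, one_pos, ?_⟩
    rw [hHμ, h0, smul_zero]
    exact IsRationalClass.zero
  have hconj := hKV.conjClass_eq
  rw [hHμ] at hconj
  change conjClass _ 2 (μ • ρX) = μ • ρX at hconj
  rw [conjClass_smul, hρXrat.conjClass_eq] at hconj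
  have hρ0 : ρX ≠ 0 := fun h ↦ h0 (by rw [h, smul_zero])
  have hμ : starRingEnd ℂ μ = μ := smul_left_injective ℂ hρ0 hconj
  have hμre : (μ.re : ℂ) = μ := Complex.conj_eq_iff_re.1 hμ
  have hμ0 : μ.re ≠ 0 := fun h ↦ h0 (by rw [← hμre, h, Complex.ofReal_zero, zero_smul])
  refine ⟨|μ.re|⁻¹, inv_pos.2 (abs_pos.2 hμ0), ?_⟩
  rw [hHμ, smul_smul, show ((|μ.re|⁻¹ : ℝ) : ℂ) * μ = ((|μ.re|⁻¹ * μ.re : ℝ) : ℂ) by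
    rw [Complex.ofReal_mul, hμre]]
  rcases lt_or_gt_of_ne hμ0 with hneg | hpos
  · rw [abs_of_neg hneg, inv_neg, neg_mul, inv_mul_cancel₀ hμ0, Complex.ofReal_neg,
      Complex.ofReal_one]
    have h := hρXrat.smul (-1)
    rwa [Rat.cast_neg, Rat.cast_one] at h
  · rw [abs_of_pos hpos, inv_mul_cancel₀ hμ0, Complex.ofReal_one, one_smul]
    exact hρXrat

end FubiniStudy

/-! ### The signed Hodge index theorem of a surface, for the intersection form of a datum -/

section HodgeIndex

variable {X : SchemeOver ℂ}

/-- The degree bookkeeping `2 + 2 = 2 · 2` of the intersection form of a surface. [folklore] -/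
theorem two_add_two_eq : 2 + 2 = 2 * 2 := by norm_num

namespace KaehlerRationalDatum

/-- **`τ(κ ∪ κ) > 0`** for the rational Kähler class `κ = η ⊗ 1` of a Kähler–rational datum of a
smooth projective SURFACE and its normalised trace `τ` (a positive real; the case `a = 0`, `ξ = 1`
of the Hodge–Riemann relation `hodgeRiemann_X`: `L² 1 ∪ 1 = κ ∪ κ` is a positive multiple of the top
Kähler class `Ω`, and `τ(Ω) > 0`, `cTrace_topClass_pos`). [cite: VoisinHodgeI2002, §6.3.2 Thm. 6.32 and §7.1.2] -/
theorem cTrace_cup_Hη_Hη_pos (hX : Motives.IsSmoothProjective 2 X) (D : KaehlerRationalDatum 2 X) :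
    0 < (D.cTrace hX (cupProduct two_add_two_eq D.Hη D.Hη)).re ∧
      (D.cTrace hX (cupProduct two_add_two_eq D.Hη D.Hη)).im = 0 := by
  set one : complexBetti X 0 := singularCohomology.one ℂ (Motives.ComplexPoints X) with hone_def
  have h1rat : IsRationalClass one := isRationalClass_one _
  have h1typ : IsOfHodgeType 2 X 0 0 0 one := isOfHodgeType_zero_zero_zero D.B _
  have h1ne : one ≠ 0 := by
    intro h
    apply D.topClass_ne_zero hX
    have h' := cupProduct_one (R := ℂ) D.topClass
    rw [← hone_def, h, map_zero] at h'
    exact h'.symm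
  have hprim : lefschetzPow D.Hη (2 + 1) 0 one = 0 := by
    haveI := subsingleton_of_lt hX ℂ (0 + 2 * (2 + 1)) (by norm_num)
    exact Subsingleton.elim _ _
  obtain ⟨t, ht, heq⟩ := D.hodgeRiemann_X hX (a := 0) (s := 0) (t' := 0) (r₀ := 2)
    (by norm_num) (by norm_num) h1typ h1ne hprim
  have hsc : (Complex.I ^ ((0 : ℕ) - (0 : ℕ) : ℤ) * (-1) ^ (0 * (0 - 1) / 2) : ℂ) = 1 := by norm_num
  have hL : lefschetzPow D.Hη 2 0 one = cupProduct two_add_two_eq D.Hη D.Hη := by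
    simp only [lefschetzPow_succ, lefschetzPow_zero, LinearMap.comp_apply, LinearMap.id_apply,
      lefschetzOperator_apply]
    change cupProduct two_add_two_eq D.Hη (cupProduct (Nat.add_zero 2) D.Hη one) = _
    rw [hone_def, cupProduct_one]
  rw [hsc, one_smul, h1rat.conjClass_eq, hL] at heq
  have heq' : cupProduct two_add_two_eq D.Hη D.Hη = (t : ℂ) • D.topClass := by
    rw [← heq]
    exact (cupProduct_one (R := ℂ) _).symm
  obtain ⟨hre, him⟩ := D.cTrace_topClass_pos hX
  rw [heq', map_smul, smul_eq_mul]
  refine ⟨?_, ?_⟩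
  · rw [Complex.re_ofReal_mul]
    exact mul_pos ht hre
  · rw [Complex.im_ofReal_mul, him, mul_zero]

/-- **`τ(y ∪ y) < 0` for a non-zero rational primitive `(1,1)`-class `y` on a surface** (the
Hodge index theorem WITH its sign, Hartshorne V Thm. 1.9 "`D.H = 0`, `D ≢ 0` ⟹ `D² < 0`"; the case
`a = 2`, `(s, t') = (1, 1)` of `hodgeRiemann_X`: `-(y ∪ ȳ)` is a positive multiple of `Ω`, and
`ȳ = y` for a rational class). Primitivity is `κ ∪ y = 0` in `H⁴`. [cite: VoisinHodgeI2002, §6.3.2 Thm. 6.32]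
[cite: Hartshorne1977, V Thm. 1.9] -/
theorem cTrace_cup_self_neg_of_primitive (hX : Motives.IsSmoothProjective 2 X)
    (D : KaehlerRationalDatum 2 X) {y : complexBetti X 2} (hy : IsRationalClass y)
    (hy11 : IsOfHodgeType 2 X 2 1 1 y) (hy0 : y ≠ 0)
    (hprim : cupProduct two_add_two_eq D.Hη y = 0) :
    (D.cTrace hX (cupProduct two_add_two_eq y y)).re < 0 ∧
      (D.cTrace hX (cupProduct two_add_two_eq y y)).im = 0 := by
  have hprim' : lefschetzPow D.Hη (0 + 1) 2 y = 0 := by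
    simp only [lefschetzPow_succ, lefschetzPow_zero, LinearMap.comp_apply, LinearMap.id_apply,
      lefschetzOperator_apply]
    exact hprim
  obtain ⟨t, ht, heq⟩ := D.hodgeRiemann_X hX (a := 2) (s := 1) (t' := 1) (r₀ := 0)
    (by norm_num) (by norm_num) hy11 hy0 hprim'
  have hsc : (Complex.I ^ ((1 : ℕ) - (1 : ℕ) : ℤ) * (-1) ^ (2 * (2 - 1) / 2) : ℂ) = -1 := by norm_num
  rw [hsc, hy.conjClass_eq] at heq
  simp only [lefschetzPow_zero, LinearMap.id_apply, neg_one_smul] at heq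
  have heq' : cupProduct two_add_two_eq y y = -((t : ℂ) • D.topClass) := by
    rw [← heq, neg_neg]
  obtain ⟨hre, him⟩ := D.cTrace_topClass_pos hX
  rw [heq', map_neg, map_smul, smul_eq_mul]
  refine ⟨?_, ?_⟩
  · rw [Complex.neg_re, Complex.re_ofReal_mul, neg_lt_zero]
    exact mul_pos ht hre
  · rw [Complex.neg_im, Complex.im_ofReal_mul, him, mul_zero, neg_zero]

end KaehlerRationalDatum

end HodgeIndex

/-! ### The index form `2 B(κ,x) B(κ,y) - B(κ,κ) B(x,y)`: abstract positivity -/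

section IndexForm

/-- **Positivity of the index form from the signed Hodge index theorem (abstract linear algebra).**
Let `V` be a `ℂ`-module with a predicate `rat` of "rational" vectors stable under differences and
rational multiples, `B` a `ℂ`-bilinear form on `V` symmetric and RATIONAL-valued on rational vectors,
and `κ` a rational vector with `B(κ, κ) = q₀ > 0` such that `B(y, y) < 0` for every non-zero rational
`y` with `B(κ, y) = 0` (signature `(1, m)` on the rational vectors, `κ` positive). Then the form
`Q(x, y) = 2 B(κ, x) B(κ, y) - B(κ, κ) B(x, y)` takes a POSITIVE rational value `Q(x, x)` at every
non-zero rational `x`: writing `x = a κ + y` with `a = B(κ, x)/q₀ ∈ ℚ` and `B(κ, y) = 0`,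
`Q(x, x) = B(κ, x)² - q₀ B(y, y)`. (Hartshorne V Rem. 1.9.1: the intersection form is negative
definite on `h^⊥`; this is the definite form it yields.) [cite: Hartshorne1977, V Thm. 1.9 and Rem. 1.9.1] -/
theorem indexForm_self_pos_of_neg_on_primitive {V : Type*} [AddCommGroup V] [Module ℂ V]
    (rat : V → Prop) (hsub : ∀ x y, rat x → rat y → rat (x - y))
    (hsmul : ∀ (q : ℚ) (x : V), rat x → rat ((q : ℂ) • x))
    (B : V →ₗ[ℂ] V →ₗ[ℂ] ℂ) (hBsymm : ∀ x y, B x y = B y x)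
    (hBrat : ∀ x y, rat x → rat y → ∃ q : ℚ, B x y = q)
    (κ : V) (hκ : rat κ) (q₀ : ℚ) (hq₀ : 0 < q₀) (hκκ : B κ κ = q₀)
    (hneg : ∀ y, rat y → y ≠ 0 → B κ y = 0 → ∃ q : ℚ, q < 0 ∧ B y y = q)
    (x : V) (hx : rat x) (hx0 : x ≠ 0) :
    ∃ r : ℚ, 0 < r ∧ 2 * B κ x * B κ x - B κ κ * B x x = r := by
  obtain ⟨q₁, hq₁⟩ := hBrat κ x hκ hx
  have hq₀0 : (q₀ : ℂ) ≠ 0 := by exact_mod_cast hq₀.ne'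
  obtain ⟨a, ha⟩ : ∃ a : ℚ, a = q₁ / q₀ := ⟨_, rfl⟩
  obtain ⟨y, hxy⟩ : ∃ y : V, x = y + (a : ℂ) • κ := ⟨x - (a : ℂ) • κ, by rw [sub_add_cancel]⟩
  have hyrat : rat y := by
    have h : y = x - (a : ℂ) • κ := by rw [hxy, add_sub_cancel_right]
    rw [h]
    exact hsub _ _ hx (hsmul a κ hκ)
  have hκx : B κ x = (a : ℂ) * q₀ := by
    rw [hq₁, ha, Rat.cast_div, div_mul_cancel₀ _ hq₀0]
  have hκy : B κ y = 0 := by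
    have h : y = x - (a : ℂ) • κ := by rw [hxy, add_sub_cancel_right]
    rw [h, map_sub, map_smul, hκx, hκκ, smul_eq_mul, sub_self]
  have hyκ : B y κ = 0 := by rw [hBsymm, hκy]
  have hxx : B x x = B y y + (a : ℂ) * a * q₀ := by
    rw [hxy]
    simp only [map_add, map_smul, LinearMap.add_apply, LinearMap.smul_apply, smul_eq_mul, hκy, hyκ, hκκ]
    ring
  by_cases hy0 : y = 0
  · -- `x = a κ`, `a ≠ 0`
    have ha0 : a ≠ 0 := by
      rintro ha0
      apply hx0
      rw [hxy, hy0, ha0, Rat.cast_zero, zero_smul, add_zero]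
    refine ⟨a * a * (q₀ * q₀), mul_pos (mul_self_pos.2 ha0) (mul_pos hq₀ hq₀), ?_⟩
    rw [hxx, hy0, hκx, hκκ]
    simp only [map_zero, zero_add]
    push_cast
    ring
  · obtain ⟨q₃, hq₃, hyy⟩ := hneg y hyrat hy0 hκy
    refine ⟨q₁ * q₁ - q₀ * q₃, ?_, ?_⟩
    · nlinarith [mul_self_nonneg q₁, mul_pos hq₀ (neg_pos.2 hq₃)]
    · have hq₁' : (q₁ : ℂ) = a * q₀ := by rw [← hκx, hq₁]
      rw [hxx, hyy, hκκ, hκx]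
      push_cast
      rw [hq₁']
      ring

end IndexForm

/-! ### The intersection form of a datum on a surface: rationality, definiteness, rigidity -/

section Surface

variable {X : SchemeOver ℂ}

namespace KaehlerRationalDatum

/-- The normalised trace `τ` of a datum is injective on the line `H^{2n}(X(ℂ); ℂ)` (it is `± λ_ℂ`,
the coordinate along the rational generator). [folklore] -/
theorem eq_zero_of_cTrace_eq_zero {n : ℕ} (hX : Motives.IsSmoothProjective n X)
    (D : KaehlerRationalDatum n X) {z : complexBetti X (2 * n)} (hz : D.cTrace hX z = 0) : z = 0 := by
  have hε : (algebraMap ℚ ℂ (D.traceSign hX)) ≠ 0 := by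
    rw [ne_eq, map_eq_zero_iff _ (algebraMap ℚ ℂ).injective, traceSign]
    split_ifs <;> norm_num
  have hc : cTopCoord hX z = 0 := by
    have h : (algebraMap ℚ ℂ (D.traceSign hX)) * cTopCoord hX z = 0 := hz
    exact (mul_eq_zero.1 h).resolve_left hε
  rw [← cTopCoord_smul_self hX z, hc, zero_smul]

/-- The intersection number `τ(x ∪ y)` of RATIONAL classes of a surface is rational (cup products of
rational classes are rational, `IsRationalClass.cup`; `τ_ℂ` extends `τ_ℚ`, `cTrace_ofRatClass`).
[cite: VoisinHodgeI2002, §7.1.1 and §7.1.2] -/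
theorem exists_cTrace_cup_eq_ratCast (hX : Motives.IsSmoothProjective 2 X) (D : KaehlerRationalDatum 2 X)
    {x y : complexBetti X 2} (hx : IsRationalClass x) (hy : IsRationalClass y) :
    ∃ q : ℚ, D.cTrace hX (cupProduct two_add_two_eq x y) = q := by
  obtain ⟨z, hz⟩ := (hx.cup two_add_two_eq hy).exists_ringChange_eq
  refine ⟨D.ratTrace hX z, ?_⟩
  rw [← hz, D.cTrace_ofRatClass hX z, eq_ratCast]

/-- Rational classes are stable under differences. [folklore] -/
theorem _root_.Literature.AlgebraicGeometry.HodgeTheory.IsRationalClass.sub' {Y : Type u}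
    [TopologicalSpace Y] {k : ℕ} {c c' : singularCohomology ℂ ℂ Y k} (hc : IsRationalClass c)
    (hc' : IsRationalClass c') : IsRationalClass (c - c') := by
  have h := hc.add (hc'.smul (-1))
  rwa [Rat.cast_neg, Rat.cast_one, neg_one_smul, ← sub_eq_add_neg] at h

/-- **Positivity of the index form of a Kähler–rational datum on a surface all of whose rational
degree-2 classes are of type `(1,1)`** (e.g. `p_g = 0`): for `B(x, y) = τ(x ∪ y)` and the Kähler
class `κ`, the rational number `2 B(κ,x)² - B(κ,κ) B(x,x)` is POSITIVE at every non-zero rational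
`x ∈ H²(X(ℂ); ℂ)` — `indexForm_self_pos_of_neg_on_primitive` fed with the signed Hodge index theorem
(`cTrace_cup_Hη_Hη_pos`, `cTrace_cup_self_neg_of_primitive`; `B(κ, y) = 0` forces `κ ∪ y = 0` on
the line `H⁴`). [cite: Hartshorne1977, V Thm. 1.9 and Rem. 1.9.1] [cite: VoisinHodgeI2002, §6.3.2 Thm. 6.32] -/
theorem indexForm_self_pos (hX : Motives.IsSmoothProjective 2 X) (D : KaehlerRationalDatum 2 X)
    (h11 : ∀ y : complexBetti X 2, IsRationalClass y → IsOfHodgeType 2 X 2 1 1 y)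
    (B : complexBetti X 2 →ₗ[ℂ] complexBetti X 2 →ₗ[ℂ] ℂ)
    (hB : ∀ u v, B u v = D.cTrace hX (cupProduct two_add_two_eq u v))
    {x : complexBetti X 2} (hx : IsRationalClass x) (hx0 : x ≠ 0) :
    ∃ r : ℚ, 0 < r ∧ 2 * B D.Hη x * B D.Hη x - B D.Hη D.Hη * B x x = r := by
  obtain ⟨q₀, hq₀⟩ := D.exists_cTrace_cup_eq_ratCast hX D.isRationalClass_Hη D.isRationalClass_Hη
  obtain ⟨hpos, -⟩ := D.cTrace_cup_Hη_Hη_pos hX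
  have hq₀pos : 0 < q₀ := by
    rw [hq₀, Complex.ratCast_re] at hpos
    exact_mod_cast hpos
  refine indexForm_self_pos_of_neg_on_primitive (V := complexBetti X 2) IsRationalClass
    (fun u v hu hv ↦ hu.sub' hv) (fun q u hu ↦ hu.smul q) B
    (fun u v ↦ by rw [hB, hB]; exact congrArg (D.cTrace hX) (cupProduct_comm_two_two ℂ u v))
    (fun u v hu hv ↦ by rw [hB]; exact D.exists_cTrace_cup_eq_ratCast hX hu hv)
    D.Hη D.isRationalClass_Hη q₀ hq₀pos (by rw [hB, hq₀]) (fun y hy hy0 hκy ↦ ?_) x hx hx0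
  -- the signed Hodge index theorem for the primitive rational class `y`
  rw [hB] at hκy
  have hprim : cupProduct two_add_two_eq D.Hη y = 0 := D.eq_zero_of_cTrace_eq_zero hX hκy
  obtain ⟨hneg, -⟩ := D.cTrace_cup_self_neg_of_primitive hX hy (h11 y hy) hy0 hprim
  obtain ⟨q, hq⟩ := D.exists_cTrace_cup_eq_ratCast hX hy hy
  refine ⟨q, ?_, by rw [hB, hq]⟩
  rw [hq, Complex.ratCast_re] at hneg
  exact_mod_cast hneg

/-- **Rigidity on the top line**: a homogeneous self-map `T₄` of `H⁴(X(ℂ); ℂ)` of a smooth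
projective surface fixing `κ ∪ κ` (for the Kähler class `κ` of a datum — a non-zero vector of the
line `H⁴`, `τ(κ ∪ κ) > 0`) is the identity; in particular `τ ∘ T₄ = τ`. [folklore] -/
theorem cTrace_apply_eq_of_map_cup_Hη_Hη (hX : Motives.IsSmoothProjective 2 X) (D : KaehlerRationalDatum 2 X)
    (T : complexBetti X (2 * 2) → complexBetti X (2 * 2)) (hTsmul : ∀ (c : ℂ) (z : complexBetti X (2 * 2)),
      T (c • z) = c • T z)
    (hT : T (cupProduct two_add_two_eq D.Hη D.Hη) = cupProduct two_add_two_eq D.Hη D.Hη)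
    (z : complexBetti X (2 * 2)) : D.cTrace hX (T z) = D.cTrace hX z := by
  have hw0 : cupProduct two_add_two_eq D.Hη D.Hη ≠ 0 := by
    intro h0
    obtain ⟨hpos, -⟩ := D.cTrace_cup_Hη_Hη_pos hX
    rw [h0, map_zero, Complex.zero_re] at hpos
    exact lt_irrefl _ hpos
  haveI := finite_complexBetti hX (2 * 2)
  obtain ⟨c, rfl⟩ :=
    (finrank_eq_one_iff_of_nonzero' _ hw0).1 (finrank_complexBetti_two_mul_eq_one hX) z
  rw [hTsmul, hT]

end KaehlerRationalDatum

end Surface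

/-! ### Finite monodromy orbits on `H²` of a fibre with `p_g = 0` -/

section Family

/-- **Finite monodromy on `H²` of a geometric-genus-zero fibre of a smooth projective family of
surfaces.** Let `f : 𝒳 ⟶ S` be a smooth projective family of relative dimension `2` over a
quasi-projective base smooth of pure dimension `d` over `ℂ` (so that `R² f_* ℂ` is a local system on
`S(ℂ)`), `s ∈ S(ℂ)` a point whose fibre `X_s` has `H^{2,0} = 0` (a Hodge model `A` with
`dim H^{2,0}(A) = 0`), and `j : 𝒳 ⟶ ℙᴹ` a morphism embedding the fibre (`X_s ⟶ 𝒳 ⟶ ℙᴹ` a closed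
immersion — e.g. `𝒳` open in a projective variety). Then every RATIONAL class `α ∈ H²(X_s(ℂ); ℂ)`
has only finitely many flat continuations along loops at `s`: its monodromy orbit is FINITE. Proof:
`H²(X_s) = H^{1,1}` (`isOfHodgeType_one_one_of_pg_zero`), so the index form `Q` of a Kähler–rational
datum of `X_s` whose Kähler class `κ` is the restriction of the global class `c • j^*ρ`
(`exists_kaehlerRationalDatum_Hη_eq_smul_map`) is a positive definite rational form on
`H²(X_s(ℂ); ℚ)` (`KaehlerRationalDatum.indexForm_self_pos`); transport along loops fixes `κ`
(`transportFun_map_fiberι`), is multiplicative (`transportFun_cupProduct`) and acts trivially on the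
line `H⁴` (`cTrace_apply_eq_of_map_cup_Hη_Hη`), so it preserves `Q`; and the translates of `α` are
then integral-up-to-`N` classes of bounded `Q`-norm, finite in number
(`finite_setOf_isContinuationAlong_of_norm_eq`). This is the finiteness of the monodromy of a
polarised integral variation of Hodge structure of type `(1,1)` (Deligne; Cattani–Deligne–Kaplan)
behind "after a finite base change" in Arapura's proof of Cor. 1.5. [cite: DeligneHodgeII1971, 4.2]
[cite: CattaniDeligneKaplan1995JAMS, §1] [cite: VoisinHodgeII2003, §3.1.2]
[cite: Arapura2022, proof of Cor. 1.5 (p. 5)] -/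
theorem finite_setOf_isContinuationAlong_of_pg_zero {𝒳 S : SchemeOver ℂ} (f : 𝒳 ⟶ S) (d : ℕ)
    (hf : IsSmoothProjectiveFamily f 2) (hS : IsQuasiProjectiveOver S) [SmoothOfRelativeDimension d S.hom]
    (s : ComplexPoints S)
    (hpg : ∃ A : HodgeModel 2 (fiberOver f s), Module.finrank ℂ ↥(A.hodgePQ 2 2 0) = 0)
    {M : ℕ} (j : 𝒳 ⟶ projectiveSpace M ℂ) [IsClosedImmersion (fiberι f s ≫ j).left]
    (α : complexBetti (fiberOver f s) 2) (hα : IsRationalClass α) :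
    {β : complexBetti (fiberOver f s) 2 | ∃ γ : Path s s, IsContinuationAlong γ α β}.Finite := by
  have hX : Motives.IsSmoothProjective 2 (fiberOver f s) := hf.isSmoothProjective s
  obtain ⟨A, hA⟩ := hpg
  have h11 : ∀ y : complexBetti (fiberOver f s) 2, IsRationalClass y →
      IsOfHodgeType 2 (fiberOver f s) 2 1 1 y :=
    fun y _ ↦ isOfHodgeType_one_one_of_pg_zero hX A hA y
  -- a datum of the fibre whose Kähler class is the restriction of a global class `K`
  obtain ⟨D, ρ, c, -, hκ⟩ := exists_kaehlerRationalDatum_Hη_eq_smul_map hX (fiberι f s ≫ j)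
  have hκK : D.Hη = complexBetti.map (fiberι f s) 2 (c • complexBetti.map j 2 ρ) := by
    rw [hκ, map_smul, complexBetti.map_comp, ModuleCat.comp_apply]
  -- the local system; invariance of `κ`, of cup products and of the trace under transport
  have hU : IsCohomologicallyLocallyTrivialOn f (Set.univ : Set (ComplexPoints S)) :=
    isCohomologicallyLocallyTrivialOn_univ_of_isSmoothProjectiveFamily f d hf hS
  have hTκ : ∀ γ : Path.Homotopic.Quotient (⟨s, Set.mem_univ s⟩ : (Set.univ : Set (ComplexPoints S)))
      ⟨s, Set.mem_univ s⟩, transportFun f 2 hU γ D.Hη = D.Hη := fun γ ↦ by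
    rw [hκK]
    exact transportFun_map_fiberι f 2 hU γ _
  have hTB : ∀ (γ : Path.Homotopic.Quotient (⟨s, Set.mem_univ s⟩ : (Set.univ : Set (ComplexPoints S)))
      ⟨s, Set.mem_univ s⟩) (x y : complexBetti (fiberOver f s) 2),
      D.cTrace hX (cupProduct two_add_two_eq (transportFun f 2 hU γ x) (transportFun f 2 hU γ y)) =
        D.cTrace hX (cupProduct two_add_two_eq x y) := fun γ x y ↦ by
    rw [← transportFun_cupProduct f hU two_add_two_eq γ x y]
    exact D.cTrace_apply_eq_of_map_cup_Hη_Hη hX (transportFun f (2 * 2) hU γ :)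
      (transportFun_smul f (2 * 2) hU γ) (by rw [transportFun_cupProduct f hU two_add_two_eq γ, hTκ]) _
  -- the intersection form `B` and the index form `Q`
  obtain ⟨B, hB⟩ : ∃ B : complexBetti (fiberOver f s) 2 →ₗ[ℂ] complexBetti (fiberOver f s) 2 →ₗ[ℂ] ℂ,
      ∀ u v, B u v = D.cTrace hX (cupProduct two_add_two_eq u v) :=
    ⟨(cupProduct two_add_two_eq).compr₂ (D.cTrace hX), fun u v ↦ LinearMap.compr₂_apply _ _ _ _⟩
  obtain ⟨Q, hQ⟩ : ∃ Q : complexBetti (fiberOver f s) 2 →ₗ[ℂ] complexBetti (fiberOver f s) 2 →ₗ[ℂ] ℂ,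
      ∀ u v, Q u v = 2 * B D.Hη u * B D.Hη v - B D.Hη D.Hη * B u v := by
    refine ⟨(2 : ℂ) • (LinearMap.mul ℂ ℂ).compl₁₂ (B D.Hη) (B D.Hη) - (B D.Hη D.Hη) • B, fun u v ↦ ?_⟩
    simp only [LinearMap.sub_apply, LinearMap.smul_apply, LinearMap.compl₁₂_apply,
      LinearMap.mul_apply', smul_eq_mul]
    ring
  have hQrat : ∀ x y, IsRationalClass x → IsRationalClass y → ∃ q : ℚ, Q x y = q := by
    intro x y hx hy
    obtain ⟨q₁, hq₁⟩ := D.exists_cTrace_cup_eq_ratCast hX D.isRationalClass_Hη hx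
    obtain ⟨q₂, hq₂⟩ := D.exists_cTrace_cup_eq_ratCast hX D.isRationalClass_Hη hy
    obtain ⟨q₀, hq₀⟩ := D.exists_cTrace_cup_eq_ratCast hX D.isRationalClass_Hη D.isRationalClass_Hη
    obtain ⟨q₃, hq₃⟩ := D.exists_cTrace_cup_eq_ratCast hX hx hy
    refine ⟨2 * q₁ * q₂ - q₀ * q₃, ?_⟩
    rw [hQ, hB, hB, hB, hB, hq₁, hq₂, hq₀, hq₃]
    push_cast
    ring
  have hQpos : ∀ x, IsRationalClass x → True → x ≠ 0 → ∃ r : ℚ, 0 < r ∧ Q x x = r := by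
    intro x hx _ hx0
    obtain ⟨r, hr, h⟩ := D.indexForm_self_pos hX h11 B hB hx hx0
    exact ⟨r, hr, by rw [hQ]; exact h⟩
  have hQorb : ∀ γ : Path.Homotopic.Quotient (⟨s, Set.mem_univ s⟩ : (Set.univ : Set (ComplexPoints S)))
      ⟨s, Set.mem_univ s⟩, Q (transportFun f 2 hU γ α :) (transportFun f 2 hU γ α :) = Q α α := fun γ ↦ by
    have h1 : B D.Hη (transportFun f 2 hU γ α :) = B D.Hη α := by
      rw [hB, hB]
      conv_lhs => rw [← hTκ γ]
      exact hTB γ D.Hη α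
    have h2 : B (transportFun f 2 hU γ α :) (transportFun f 2 hU γ α :) = B α α := by
      rw [hB, hB]
      exact hTB γ α α
    rw [hQ, hQ, h1, h2]
  exact finite_setOf_isContinuationAlong_of_norm_eq f 2 d hf hS s (fun _ ↦ True) trivial
    (fun _ _ _ _ ↦ trivial) (fun _ _ _ ↦ trivial) Q hQrat hQpos α hα (fun _ ↦ trivial) hQorb

end Family

end Literature.AlgebraicGeometry.HodgeTheory

end
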